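import Summits.QuantumFields.QCD.Theorems.PauliWegnerSeaFMClosureUnquenchedClosureC1Aux5

/-!
# Crux `FMClosureUnquenched` (stmt-QuantumFields-11512), line `von-mises-circles`, stub `stub_closure`:
helper 6 — polynomial bookkeeping of the bootstrap constants

All losses of the thick-collar bootstrap are polynomial in the size parameter `Θ = ℓ₀ (1 + |β|)`: with
`𝕂 = max (max 2 c_T²) (max (max (C 6^{p⁺}) (C_f 6^{p_f⁺})) 14⁴)` and `𝕔 = 2p⁺ + 2p_f⁺ + 4` every factor
`c_T^t`, `(c_T²)^t`, `Ξ_r = C(1+|β|)^p(1+r)^p` (`r ≤ 3ℓ₀+2`), `R_ℓ`, `|sphere|`, `|boxIn|`, `|boxOut|` is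
`≤ 𝕂 Θ^𝕔`, and products are tracked as `𝕂^a Θ^{a𝕔}`.  Then, at one volume and under the packaged clauses:

* `c1_ratefree` — the rate-free bound `E(0, v) ≤ 𝕂⁴ Θ^{4𝕔} Θ^{-κ}` for every `v ∈ box S` with `‖v‖_∞ ≥ ℓ₀`, from
  the shell hypothesis `E(0, w) ≤ Θ^{-κ}` (`‖w‖_∞ = ℓ₀`) and the forward step `c1_exterior_le`;
* `c1_exit_small` — the exit moment `A(u) ≤ 𝕂⁹ Θ^{9𝕔} Θ^{-κ}` on `boxIn ℓ₀` (`c1_exit_le`).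

References: Aizenman–Schenker–Friedrich–Hundertmark, CMP 224 (2001) 219, §2 [AizenmanEtAl2001].
-/

noncomputable section

open scoped BigOperators
open MeasureTheory Filter
open Literature.MathematicalPhysics.QuantumFieldTheory Literature.MathematicalPhysics.QuantumLattice
  Literature.Probability.LatticeModels
open Summit.QuantumFields.QCD.Theorems.VonMisesCircles

namespace Summit.QuantumFields.QCD.Theorems.VonMisesCirclesC1

/-! ## Monomial bookkeeping -/

/-- **Registered helper `c1_mono_mul` of crux stmt-QuantumFields-11512** (line `von-mises-circles`, stub
`stub_closure`): product of two monomial bounds `X ≤ K^a Θ^{a c}`, `Y ≤ K^b Θ^{b c}`. [folklore] -/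
theorem c1_mono_mul : ∀ {K Θ c X Y : ℝ} {a b n : ℕ}, a + b = n → 1 ≤ Θ → 0 ≤ X → 0 ≤ Y → X ≤ K ^ a * Θ ^ ((a : ℝ) * c) → Y ≤ K ^ b * Θ ^ ((b : ℝ) * c) → X * Y ≤ K ^ n * Θ ^ ((n : ℝ) * c) := by
  intro K Θ c X Y a b n hn hΘ hX0 hY0 hX hY
  subst hn
  have hΘ0 : 0 < Θ := by linarith
  calc X * Y ≤ (K ^ a * Θ ^ ((a : ℝ) * c)) * (K ^ b * Θ ^ ((b : ℝ) * c)) :=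
        mul_le_mul hX hY hY0 (hX0.trans hX)
    _ = K ^ (a + b) * Θ ^ (((a + b : ℕ) : ℝ) * c) := by
        rw [pow_add, Nat.cast_add, add_mul, Real.rpow_add hΘ0]; ring

/-- Weakening a monomial bound: `X ≤ K' Θ^{c'}` with `K' ≤ K`, `c' ≤ c` gives `X ≤ K^1 Θ^{1·c}`. [folklore] -/
theorem c1_mono_of_le {K Θ c K' c' X : ℝ} (hΘ : 1 ≤ Θ) (hK' : 0 ≤ K') (hKK : K' ≤ K) (hcc : c' ≤ c)
    (hX : X ≤ K' * Θ ^ c') : X ≤ K ^ 1 * Θ ^ (((1 : ℕ) : ℝ) * c) := by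
  rw [pow_one, Nat.cast_one, one_mul]
  exact hX.trans (mul_le_mul hKK (Real.rpow_le_rpow_of_exponent_le hΘ hcc) (Real.rpow_nonneg (by linarith) _) (hK'.trans hKK))

/-- Sum of two quantities with the same monomial bound (`2 ≤ K`). [folklore] -/
theorem c1_mono_add {K Θ c X Y : ℝ} {a n : ℕ} (hn : a + 1 = n) (hK : 2 ≤ K) (hΘ : 1 ≤ Θ) (hc : 0 ≤ c)
    (hX : X ≤ K ^ a * Θ ^ ((a : ℝ) * c)) (hY : Y ≤ K ^ a * Θ ^ ((a : ℝ) * c)) :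
    X + Y ≤ K ^ n * Θ ^ ((n : ℝ) * c) := by
  subst hn
  have hK1 : 1 ≤ K := by linarith
  have h0 : 0 ≤ K ^ a * Θ ^ ((a : ℝ) * c) := by positivity
  calc X + Y ≤ 2 * (K ^ a * Θ ^ ((a : ℝ) * c)) := by linarith
    _ ≤ K * (K ^ a * Θ ^ ((a : ℝ) * c)) * Θ ^ c := by
        have h1 : 1 ≤ Θ ^ c := Real.one_le_rpow hΘ hc
        have h2 : 2 * (K ^ a * Θ ^ ((a : ℝ) * c)) ≤ K * (K ^ a * Θ ^ ((a : ℝ) * c)) :=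
          mul_le_mul_of_nonneg_right hK h0
        exact h2.trans (le_mul_of_one_le_right (by positivity) h1)
    _ = K ^ (a + 1) * Θ ^ (((a + 1 : ℕ) : ℝ) * c) := by
        rw [pow_succ, Nat.cast_add, Nat.cast_one, add_mul, one_mul, Real.rpow_add (by linarith)]; ring

/-- `1 + X ≤ K^{a+1} Θ^{(a+1)𝕔}` when `X ≤ K^a Θ^{a𝕔}` and `2 ≤ K`. [folklore] -/
theorem c1_mono_one_add {K Θ c X : ℝ} {a n : ℕ} (hn : a + 1 = n) (hK : 2 ≤ K) (hΘ : 1 ≤ Θ) (hc : 0 ≤ c)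
    (hX : X ≤ K ^ a * Θ ^ ((a : ℝ) * c)) : 1 + X ≤ K ^ n * Θ ^ ((n : ℝ) * c) := by
  have hK1 : 1 ≤ K := by linarith
  have h1 : (1 : ℝ) ≤ K ^ a * Θ ^ ((a : ℝ) * c) := by
    rw [← one_mul (1 : ℝ)]
    exact mul_le_mul (one_le_pow₀ hK1) (Real.one_le_rpow hΘ (by positivity)) zero_le_one (by positivity)
  exact c1_mono_add hn hK hΘ hc h1 hX

/-! ## The loss factors -/

section Factors

variable {C p Cf pf cT 𝕂 𝕔 : ℝ} (hC : 0 < C) (hCf : 0 < Cf) (hcT : 0 < cT)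
  (h𝕂 : 𝕂 = max (max 2 (cT ^ 2)) (max (max (C * 6 ^ (max p 0)) (Cf * 6 ^ (max pf 0))) ((14 : ℝ) ^ 4)))
  (h𝕔 : 𝕔 = 2 * max p 0 + 2 * max pf 0 + 4)

include h𝕂 in
/-- `2 ≤ 𝕂`. [folklore] -/
theorem c1_two_le_K : 2 ≤ 𝕂 := by rw [h𝕂]; exact le_max_of_le_left (le_max_left _ _)

include h𝕔 in
/-- `0 ≤ 𝕔`. [folklore] -/
theorem c1_c_nonneg : 0 ≤ 𝕔 := by rw [h𝕔]; positivity

include h𝕂 hcT in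
/-- `c_T^t ≤ 𝕂` and `(c_T²)^t ≤ 𝕂` for `0 < t ≤ 1`. [folklore] -/
theorem c1_cT_rpow_le {t : ℝ} (ht0 : 0 < t) (ht1 : t ≤ 1) : cT ^ t ≤ 𝕂 ∧ (cT ^ 2) ^ t ≤ 𝕂 := by
  have h2 : cT ^ 2 ≤ 𝕂 := by rw [h𝕂]; exact le_max_of_le_left (le_max_right _ _)
  have h1 : (1 : ℝ) ≤ 𝕂 := by linarith [c1_two_le_K h𝕂]
  have key : ∀ x : ℝ, 0 < x → x ≤ 𝕂 → x ^ t ≤ 𝕂 := fun x hx hx𝕂 => by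
    rcases le_or_gt 1 x with h | h
    · exact ((Real.rpow_le_rpow_of_exponent_le h ht1).trans_eq (Real.rpow_one x)).trans hx𝕂
    · exact (Real.rpow_le_one hx.le h.le ht0.le).trans h1
  refine ⟨key cT hcT ?_, key (cT ^ 2) (by positivity) h2⟩
  rcases le_or_gt 1 cT with h | h
  · exact le_trans (by nlinarith) h2
  · linarith

include h𝕂 h𝕔 hC in
/-- `Ξ_r = C (1+|β|)^p (1+r)^p ≤ 𝕂 Θ^𝕔` whenever `1 + r ≤ 6Θ`, `1 + |β| ≤ Θ`. [folklore] -/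
theorem c1_Xi_le {β r Θ : ℝ} (hΘ1 : 1 ≤ Θ) (hβΘ : 1 + |β| ≤ Θ) (hr0 : 0 ≤ r) (hrΘ : 1 + r ≤ 6 * Θ) :
    C * (1 + |β|) ^ p * (1 + r) ^ p ≤ 𝕂 ^ 1 * Θ ^ (((1 : ℕ) : ℝ) * 𝕔) := by
  have hβ1 : 1 ≤ 1 + |β| := by have := abs_nonneg β; linarith
  have hr1 : 1 ≤ 1 + r := by linarith
  have hp : p ≤ max p 0 := le_max_left _ _
  have hp0 : 0 ≤ max p 0 := le_max_right _ _
  have h1 : (1 + |β|) ^ p ≤ Θ ^ max p 0 :=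
    (Real.rpow_le_rpow_of_exponent_le hβ1 hp).trans (Real.rpow_le_rpow (by positivity) hβΘ hp0)
  have h2 : (1 + r) ^ p ≤ (6 : ℝ) ^ max p 0 * Θ ^ max p 0 := by
    calc (1 + r) ^ p ≤ (1 + r) ^ max p 0 := Real.rpow_le_rpow_of_exponent_le hr1 hp
      _ ≤ (6 * Θ) ^ max p 0 := Real.rpow_le_rpow (by positivity) hrΘ hp0
      _ = _ := Real.mul_rpow (by norm_num) (by linarith)
  refine c1_mono_of_le hΘ1 (K' := C * 6 ^ max p 0) (c' := 2 * max p 0) (by positivity) ?_ ?_ ?_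
  · rw [h𝕂]; exact le_max_of_le_right (le_max_of_le_left (le_max_left _ _))
  · rw [h𝕔]; have := le_max_right pf 0; linarith
  · calc C * (1 + |β|) ^ p * (1 + r) ^ p ≤ C * Θ ^ max p 0 * ((6 : ℝ) ^ max p 0 * Θ ^ max p 0) :=
          mul_le_mul (mul_le_mul_of_nonneg_left h1 hC.le) h2 (Real.rpow_nonneg (by positivity) _) (by positivity)
      _ = C * 6 ^ max p 0 * Θ ^ (2 * max p 0) := by
          rw [two_mul, Real.rpow_add (by linarith)]; ring

include h𝕂 h𝕔 hCf in
/-- The same for `R_ℓ = C_f (1+|β|)^{p_f} (1+ℓ)^{p_f}`. [folklore] -/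
theorem c1_R_le {β r Θ : ℝ} (hΘ1 : 1 ≤ Θ) (hβΘ : 1 + |β| ≤ Θ) (hr0 : 0 ≤ r) (hrΘ : 1 + r ≤ 6 * Θ) :
    Cf * (1 + |β|) ^ pf * (1 + r) ^ pf ≤ 𝕂 ^ 1 * Θ ^ (((1 : ℕ) : ℝ) * 𝕔) := by
  have hβ1 : 1 ≤ 1 + |β| := by have := abs_nonneg β; linarith
  have hr1 : 1 ≤ 1 + r := by linarith
  have hp : pf ≤ max pf 0 := le_max_left _ _
  have hp0 : 0 ≤ max pf 0 := le_max_right _ _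
  have h1 : (1 + |β|) ^ pf ≤ Θ ^ max pf 0 :=
    (Real.rpow_le_rpow_of_exponent_le hβ1 hp).trans (Real.rpow_le_rpow (by positivity) hβΘ hp0)
  have h2 : (1 + r) ^ pf ≤ (6 : ℝ) ^ max pf 0 * Θ ^ max pf 0 := by
    calc (1 + r) ^ pf ≤ (1 + r) ^ max pf 0 := Real.rpow_le_rpow_of_exponent_le hr1 hp
      _ ≤ (6 * Θ) ^ max pf 0 := Real.rpow_le_rpow (by positivity) hrΘ hp0
      _ = _ := Real.mul_rpow (by norm_num) (by linarith)
  refine c1_mono_of_le hΘ1 (K' := Cf * 6 ^ max pf 0) (c' := 2 * max pf 0) (by positivity) ?_ ?_ ?_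
  · rw [h𝕂]; exact le_max_of_le_right (le_max_of_le_left (le_max_right _ _))
  · rw [h𝕔]; have := le_max_right p 0; linarith
  · calc Cf * (1 + |β|) ^ pf * (1 + r) ^ pf ≤ Cf * Θ ^ max pf 0 * ((6 : ℝ) ^ max pf 0 * Θ ^ max pf 0) :=
          mul_le_mul (mul_le_mul_of_nonneg_left h1 hCf.le) h2 (Real.rpow_nonneg (by positivity) _) (by positivity)
      _ = Cf * 6 ^ max pf 0 * Θ ^ (2 * max pf 0) := by
          rw [two_mul, Real.rpow_add (by linarith)]; ring

include h𝕂 h𝕔 in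
/-- Cardinalities: `n ≤ (14 ℓ₀)^4` and `ℓ₀ ≤ Θ` give `n ≤ 𝕂 Θ^𝕔`. [folklore] -/
theorem c1_card_le {n ℓ₀ : ℕ} {Θ : ℝ} (hΘ1 : 1 ≤ Θ) (hℓΘ : (ℓ₀ : ℝ) ≤ Θ) (hn : n ≤ (14 * ℓ₀) ^ 4) :
    (n : ℝ) ≤ 𝕂 ^ 1 * Θ ^ (((1 : ℕ) : ℝ) * 𝕔) := by
  have hn' : (n : ℝ) ≤ (14 : ℝ) ^ 4 * Θ ^ (4 : ℝ) := by
    have h1 : (n : ℝ) ≤ ((14 : ℝ) * ℓ₀) ^ 4 := by exact_mod_cast hn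
    refine h1.trans ?_
    rw [mul_pow, show (4 : ℝ) = ((4 : ℕ) : ℝ) by norm_num, Real.rpow_natCast]
    exact mul_le_mul_of_nonneg_left (pow_le_pow_left₀ (Nat.cast_nonneg _) hℓΘ 4) (by norm_num)
  refine c1_mono_of_le hΘ1 (by norm_num) ?_ ?_ hn'
  · rw [h𝕂]; exact le_max_of_le_right (le_max_right _ _)
  · rw [h𝕔]; have := le_max_right p 0; have := le_max_right pf 0; linarith

include h𝕔 in
/-- A constant `≤ 𝕂` is `≤ 𝕂 Θ^𝕔`. [folklore] -/
theorem c1_const_le {x Θ : ℝ} (hΘ1 : 1 ≤ Θ) (hx0 : 0 ≤ x) (hx : x ≤ 𝕂) : x ≤ 𝕂 ^ 1 * Θ ^ (((1 : ℕ) : ℝ) * 𝕔) :=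
  c1_mono_of_le hΘ1 hx0 hx (c1_c_nonneg h𝕔) (c' := 0) (by rw [Real.rpow_zero, mul_one])

end Factors

/-! ## The rate-free bound and the exit moment at one volume -/

section Volume

variable {Nf S : ℕ} {β t s₀ C p Cf pf θ cT 𝕂 𝕔 : ℝ} {mq : Fin Nf → ℝ} {f : Fin Nf}

variable (ht0 : 0 < t) (ht1 : t ≤ 1) (hts : t ≤ s₀) (hcT : 0 < cT) (hC : 0 < C)
  (h𝕂 : 𝕂 = max (max 2 (cT ^ 2)) (max (max (C * 6 ^ (max p 0)) (Cf * 6 ^ (max pf 0))) ((14 : ℝ) ^ 4)))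
  (h𝕔 : 𝕔 = 2 * max p 0 + 2 * max pf 0 + 4)
  (hT0 : ∀ (s₁ s₂ s₃ : ℝ), 0 ≤ s₁ → s₁ ≤ s₀ → 0 ≤ s₂ → s₂ ≤ s₀ → 0 ≤ s₃ → s₃ ≤ s₀ →
      ∀ (A₁ A₂ A₃ : Finset (TorusSite 4 (2 * S + 1))),
        AdmissibleSide S A₁ → AdmissibleSide S A₂ → AdmissibleSide S A₃ →
      ∀ (a₁ b₁ a₂ b₂ a₃ b₃ : TorusSite 4 (2 * S + 1)),
      Integrable (fun U : GaugeConfig 4 (2 * S + 1) (Matrix.specialUnitaryGroup (Fin 3) ℂ) =>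
        ‖(diracMatrix U mq).det‖ *
          (blockNorm (gside A₁ (wilsonD U (mq f))) a₁ b₁ ^ s₁ *
            blockNorm (gside A₂ (wilsonD U (mq f))) a₂ b₂ ^ s₂ *
            blockNorm (gside A₃ (wilsonD U (mq f))) a₃ b₃ ^ s₃))
        (wilsonMeasure (fundamentalRep (Fin 3)) β))
  (hTinv : ∀ (A : Finset (TorusSite 4 (2 * S + 1))), AdmissibleSide S A →
      ∀ᵐ U ∂(wilsonMeasure (d := 4) (L := 2 * S + 1) (fundamentalRep (Fin 3)) β),
        (sideMatrix A (wilsonD U (mq f))).det ≠ 0)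
  (hTdec : ∀ (x : TorusSite 4 (2 * S + 1)) (r : ℕ), 1 ≤ r → r + 1 ≤ S →
      ∀ (A : Finset (TorusSite 4 (2 * S + 1))),
        (A = ebox S x r ∨ A = (ebox S x r)ᶜ ∨ A = (ball S x r)ᶜ) →
      ∀ a b c d : TorusSite 4 (2 * S + 1), a ∈ A → b ∈ A →
        pqE Nf S β mq (fun U =>
            blockNorm (gside A (wilsonD U (mq f))) a b ^ t * blockNorm (wilsonD U (mq f))⁻¹ c d ^ t) ≤
          C * (1 + |β|) ^ p * (1 + (r : ℝ)) ^ p *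
            pqE Nf S β mq (fun U => blockNorm (wilsonD U (mq f))⁻¹ c d ^ t))
  (hR : ∀ (U : GaugeConfig 4 (2 * S + 1) (Matrix.specialUnitaryGroup (Fin 3) ℂ))
      (x : TorusSite 4 (2 * S + 1)),
      (∀ r : ℕ, 1 ≤ r → r + 1 ≤ S → ∀ z : TorusSite 4 (2 * S + 1), z ∉ ball S x r →
        (sideMatrix (ball S x r)ᶜ (wilsonD U (mq f))).det ≠ 0 →
          blockNorm (wilsonD U (mq f))⁻¹ x z ≤
            cT * ∑ p ∈ sphere S x r, ∑ p' ∈ sphere S x (r + 1),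
              blockNorm (wilsonD U (mq f))⁻¹ x p * blockNorm (gside (ball S x r)ᶜ (wilsonD U (mq f))) p' z) ∧
      ∀ ℓ : ℕ, 1 ≤ ℓ → ℓ + 2 ≤ S →
        (∀ u : TorusSite 4 (2 * S + 1), u ∈ ebox S x ℓ → (wilsonD U (mq f)).det ≠ 0 →
          blockNorm (gside (ebox S x ℓ) (wilsonD U (mq f))) x u ≤
            blockNorm (wilsonD U (mq f))⁻¹ x u +
              cT * ∑ w' ∈ boxOut S x ℓ, ∑ w ∈ boxIn S x ℓ,
                blockNorm (wilsonD U (mq f))⁻¹ x w' * blockNorm (gside (ebox S x ℓ) (wilsonD U (mq f))) w u) ∧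
        (3 * ℓ + 4 ≤ S →
          (∀ v' y : TorusSite 4 (2 * S + 1), v' ∉ ebox S x (3 * ℓ + 2) → y ∉ ebox S x (3 * ℓ + 2) →
            (wilsonD U (mq f)).det ≠ 0 →
              blockNorm (gside (ebox S x (3 * ℓ + 2))ᶜ (wilsonD U (mq f))) v' y ≤
                blockNorm (wilsonD U (mq f))⁻¹ v' y +
                  cT * ∑ w' ∈ boxOut S x (3 * ℓ + 2), ∑ w ∈ boxIn S x (3 * ℓ + 2),
                    blockNorm (gside (ebox S x (3 * ℓ + 2))ᶜ (wilsonD U (mq f))) v' w' *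
                      blockNorm (wilsonD U (mq f))⁻¹ w y) ∧
          (∀ y : TorusSite 4 (2 * S + 1), y ∉ ebox S x (3 * ℓ + 2) →
            (sideMatrix (ebox S x ℓ) (wilsonD U (mq f))).det ≠ 0 →
            (sideMatrix (ebox S x (3 * ℓ + 2))ᶜ (wilsonD U (mq f))).det ≠ 0 →
              blockNorm (wilsonD U (mq f))⁻¹ x y ≤
                cT ^ 2 * ∑ u ∈ boxIn S x ℓ, ∑ u' ∈ boxOut S x ℓ,
                  ∑ v ∈ boxIn S x (3 * ℓ + 2), ∑ v' ∈ boxOut S x (3 * ℓ + 2),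
                    blockNorm (gside (ebox S x ℓ) (wilsonD U (mq f))) x u * blockNorm (wilsonD U (mq f))⁻¹ u' v *
                      blockNorm (gside (ebox S x (3 * ℓ + 2))ᶜ (wilsonD U (mq f))) v' y)))
  {ℓ₀ : ℕ} (hℓ1 : 1 ≤ ℓ₀) (hℓS : ℓ₀ ≤ S) {Θk κ : ℝ} (hΘk : Θk = (ℓ₀ : ℝ) * (1 + |β|))
  (hshell : ∀ w : Site 4, w ∈ box 4 S → ‖w‖ = (ℓ₀ : ℝ) →
    pqE Nf S β mq (fun U => blockNorm (wilsonD U (mq f))⁻¹ 0 (Torus.proj (2 * S + 1) w) ^ t) ≤ Θk ^ (-κ))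

include hℓ1 hΘk in
/-- `1 ≤ Θ`, `ℓ₀ ≤ Θ`, `1 + |β| ≤ Θ`. [folklore] -/
theorem c1_Theta_facts : 1 ≤ Θk ∧ (ℓ₀ : ℝ) ≤ Θk ∧ 1 + |β| ≤ Θk := by
  have hℓ : (1 : ℝ) ≤ ℓ₀ := by exact_mod_cast hℓ1
  have hβ : 1 ≤ 1 + |β| := by have := abs_nonneg β; linarith
  refine ⟨?_, ?_, ?_⟩
  · rw [hΘk]; nlinarith
  · rw [hΘk]; nlinarith
  · rw [hΘk]; nlinarith

include ht0 ht1 hts hcT hC h𝕂 h𝕔 hT0 hTinv hTdec hR hℓ1 hℓS hΘk hshell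

/-- **The rate-free bound off the input shell**: `E(0, v) ≤ 𝕂⁴ Θ^{4𝕔} Θ^{-κ}` for `v ∈ box S`, `‖v‖_∞ ≥ ℓ₀`.
[cite: AizenmanEtAl2001, §2 (2.11)] -/
theorem c1_ratefree (v : Site 4) (hv : v ∈ box 4 S) (hn : ℓ₀ ≤ Site.supNorm v) :
    pqE Nf S β mq (fun U => blockNorm (wilsonD U (mq f))⁻¹ 0 (Torus.proj (2 * S + 1) v) ^ t) ≤
      𝕂 ^ 4 * Θk ^ (((4 : ℕ) : ℝ) * 𝕔) * Θk ^ (-κ) := by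
  obtain ⟨hΘ1, hℓΘ, hβΘ⟩ := c1_Theta_facts hℓ1 hΘk
  have hK2 := c1_two_le_K h𝕂
  have hK1 : 1 ≤ 𝕂 := by linarith
  have hc0 := c1_c_nonneg (p := p) (pf := pf) h𝕔
  have hdec0 : 0 ≤ Θk ^ (-κ) := Real.rpow_nonneg (by linarith) _
  have hone : 1 ≤ 𝕂 ^ 4 * Θk ^ (((4 : ℕ) : ℝ) * 𝕔) := by
    rw [← one_mul (1 : ℝ)]
    exact mul_le_mul (one_le_pow₀ hK1) (Real.one_le_rpow hΘ1 (by positivity)) zero_le_one (by positivity)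
  rcases hn.eq_or_lt with heq | hlt
  · -- on the shell
    have h := hshell v hv (by rw [c1_norm_eq_supNorm, heq])
    exact h.trans (le_mul_of_one_le_left hdec0 hone)
  · -- off the shell: one forward step
    have hvS : Site.supNorm v ≤ S := mem_box_iff_supNorm_le.1 hv
    have hℓS1 : ℓ₀ + 1 ≤ S := by omega
    have hz : Torus.proj (2 * S + 1) v ∉ ball S 0 ℓ₀ := by
      have := c1_not_mem_ball_of_supNorm_lt (x := (0 : TorusSite 4 (2 * S + 1))) hv hℓS hlt
      rwa [zero_add] at this
    have h1 := c1_exterior_le ht0 ht1 hts hcT hT0 hTinv hTdec hR 0 hℓ1 hℓS1 _ hz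
    have hsum : ∑ q ∈ sphere S 0 ℓ₀, pqE Nf S β mq (fun U => blockNorm (wilsonD U (mq f))⁻¹ 0 q ^ t) ≤
        (sphere S 0 ℓ₀).card * Θk ^ (-κ) := by
      rw [← nsmul_eq_mul]
      refine Finset.sum_le_card_nsmul _ _ _ fun q hq => ?_
      obtain ⟨w, hwbox, hwnorm, rfl⟩ := c1_exists_offset_of_mem_sphere hq
      rw [zero_add]
      exact hshell w (box_mono 4 hℓS hwbox) hwnorm
    -- the loss factors
    have hf1 : cT ^ t ≤ 𝕂 ^ 1 * Θk ^ (((1 : ℕ) : ℝ) * 𝕔) :=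
      c1_const_le h𝕔 hΘ1 (Real.rpow_nonneg hcT.le _) (c1_cT_rpow_le hcT h𝕂 ht0 ht1).1
    have hf2 : C * (1 + |β|) ^ p * (1 + (ℓ₀ : ℝ)) ^ p ≤ 𝕂 ^ 1 * Θk ^ (((1 : ℕ) : ℝ) * 𝕔) :=
      c1_Xi_le hC h𝕂 h𝕔 hΘ1 hβΘ (Nat.cast_nonneg _) (by linarith)
    have hf3 : ((sphere S 0 (ℓ₀ + 1)).card : ℝ) ≤ 𝕂 ^ 1 * Θk ^ (((1 : ℕ) : ℝ) * 𝕔) :=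
      c1_card_le h𝕂 h𝕔 hΘ1 hℓΘ ((c1_card_sphere_le 0 _).trans (Nat.pow_le_pow_left (by omega) 4))
    have hf4 : ((sphere S 0 ℓ₀).card : ℝ) ≤ 𝕂 ^ 1 * Θk ^ (((1 : ℕ) : ℝ) * 𝕔) :=
      c1_card_le h𝕂 h𝕔 hΘ1 hℓΘ ((c1_card_sphere_le 0 _).trans (Nat.pow_le_pow_left (by omega) 4))
    have hΞ0 : 0 ≤ C * (1 + |β|) ^ p * (1 + (ℓ₀ : ℝ)) ^ p :=
      mul_nonneg (mul_nonneg hC.le (Real.rpow_nonneg (by positivity) _)) (Real.rpow_nonneg (by positivity) _)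
    have h12 := c1_mono_mul (n := 2) rfl hΘ1 (Real.rpow_nonneg hcT.le _) hΞ0 hf1 hf2
    have h123 := c1_mono_mul (n := 3) rfl hΘ1 (mul_nonneg (Real.rpow_nonneg hcT.le _) hΞ0) (Nat.cast_nonneg _) h12 hf3
    have h1234 := c1_mono_mul (n := 4) rfl hΘ1 (mul_nonneg (mul_nonneg (Real.rpow_nonneg hcT.le _) hΞ0) (Nat.cast_nonneg _))
      (Nat.cast_nonneg _) h123 hf4
    calc _ ≤ _ := h1
      _ ≤ cT ^ t * (C * (1 + |β|) ^ p * (1 + (ℓ₀ : ℝ)) ^ p) * (sphere S 0 (ℓ₀ + 1)).card *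
            ((sphere S 0 ℓ₀).card * Θk ^ (-κ)) :=
          mul_le_mul_of_nonneg_left hsum (mul_nonneg (mul_nonneg (Real.rpow_nonneg hcT.le _) hΞ0) (Nat.cast_nonneg _))
      _ = cT ^ t * (C * (1 + |β|) ^ p * (1 + (ℓ₀ : ℝ)) ^ p) * (sphere S 0 (ℓ₀ + 1)).card *
            (sphere S 0 ℓ₀).card * Θk ^ (-κ) := by ring
      _ ≤ _ := mul_le_mul_of_nonneg_right h1234 hdec0

/-- The rate-free bound at the torus points of `boxIn ℓ₀ ∪ boxOut ℓ₀` (`ℓ₀ + 2 ≤ S`). [folklore] -/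
theorem c1_ratefree_torus (hℓS2 : ℓ₀ + 2 ≤ S) (z : TorusSite 4 (2 * S + 1))
    (hz : z ∈ boxIn S 0 ℓ₀ ∪ boxOut S 0 ℓ₀) :
    pqE Nf S β mq (fun U => blockNorm (wilsonD U (mq f))⁻¹ 0 z ^ t) ≤
      𝕂 ^ 4 * Θk ^ (((4 : ℕ) : ℝ) * 𝕔) * Θk ^ (-κ) := by
  obtain ⟨w, hwbox, hwn, rfl⟩ := c1_exists_offset_of_mem_boxIn_union_boxOut hℓS2 hz
  rw [zero_add]
  exact c1_ratefree ht0 ht1 hts hcT hC h𝕂 h𝕔 hT0 hTinv hTdec hR hℓ1 hℓS hΘk hshell w hwbox hwn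

/-- **Smallness of the exit moment** (fit case `3ℓ₀ + 4 ≤ S`): `A(u) ≤ 𝕂⁹ Θ^{9𝕔} Θ^{-κ}` on `boxIn ℓ₀`.
[cite: AizenmanEtAl2001, §2 (2.13)] -/
theorem c1_exit_small (hfit : 3 * ℓ₀ + 4 ≤ S) (u : TorusSite 4 (2 * S + 1)) (hu : u ∈ boxIn S 0 ℓ₀) :
    pqE Nf S β mq (fun U => blockNorm (gside (ebox S 0 ℓ₀) (wilsonD U (mq f))) 0 u ^ t) ≤
      𝕂 ^ 9 * Θk ^ (((9 : ℕ) : ℝ) * 𝕔) * Θk ^ (-κ) := by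
  obtain ⟨hΘ1, hℓΘ, hβΘ⟩ := c1_Theta_facts hℓ1 hΘk
  have hK2 := c1_two_le_K h𝕂
  have hc0 := c1_c_nonneg (p := p) (pf := pf) h𝕔
  have hℓS2 : ℓ₀ + 2 ≤ S := by omega
  have hdec0 : 0 ≤ Θk ^ (-κ) := Real.rpow_nonneg (by linarith) _
  set ε : ℝ := 𝕂 ^ 4 * Θk ^ (((4 : ℕ) : ℝ) * 𝕔) * Θk ^ (-κ) with hε
  have hε0 : 0 ≤ ε := by positivity
  have h1 := c1_exit_le ht0 ht1 hts hcT hT0 hTinv hTdec hR 0 hℓ1 hℓS2 u (c1_boxIn_subset_ebox 0 ℓ₀ hu)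
  have hEu : pqE Nf S β mq (fun U => blockNorm (wilsonD U (mq f))⁻¹ 0 u ^ t) ≤ ε :=
    c1_ratefree_torus ht0 ht1 hts hcT hC h𝕂 h𝕔 hT0 hTinv hTdec hR hℓ1 hℓS hΘk hshell hℓS2 u
      (Finset.mem_union_left _ hu)
  have hsum : ∑ w' ∈ boxOut S 0 ℓ₀, pqE Nf S β mq (fun U => blockNorm (wilsonD U (mq f))⁻¹ 0 w' ^ t) ≤
      (boxOut S 0 ℓ₀).card * ε := by
    rw [← nsmul_eq_mul]
    exact Finset.sum_le_card_nsmul _ _ _ fun w' hw' =>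
      c1_ratefree_torus ht0 ht1 hts hcT hC h𝕂 h𝕔 hT0 hTinv hTdec hR hℓ1 hℓS hΘk hshell hℓS2 w'
        (Finset.mem_union_right _ hw')
  -- the loss factors
  have hf1 : cT ^ t ≤ 𝕂 ^ 1 * Θk ^ (((1 : ℕ) : ℝ) * 𝕔) :=
    c1_const_le h𝕔 hΘ1 (Real.rpow_nonneg hcT.le _) (c1_cT_rpow_le hcT h𝕂 ht0 ht1).1
  have hf2 : C * (1 + |β|) ^ p * (1 + (ℓ₀ : ℝ)) ^ p ≤ 𝕂 ^ 1 * Θk ^ (((1 : ℕ) : ℝ) * 𝕔) :=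
    c1_Xi_le hC h𝕂 h𝕔 hΘ1 hβΘ (Nat.cast_nonneg _) (by linarith)
  have hf3 : ((boxIn S 0 ℓ₀).card : ℝ) ≤ 𝕂 ^ 1 * Θk ^ (((1 : ℕ) : ℝ) * 𝕔) :=
    c1_card_le h𝕂 h𝕔 hΘ1 hℓΘ ((c1_card_boxIn_le 0 _).trans (Nat.pow_le_pow_left (by omega) 4))
  have hf4 : ((boxOut S 0 ℓ₀).card : ℝ) ≤ 𝕂 ^ 1 * Θk ^ (((1 : ℕ) : ℝ) * 𝕔) :=
    c1_card_le h𝕂 h𝕔 hΘ1 hℓΘ ((c1_card_boxOut_le 0 _).trans (Nat.pow_le_pow_left (by omega) 4))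
  have hΞ0 : 0 ≤ C * (1 + |β|) ^ p * (1 + (ℓ₀ : ℝ)) ^ p :=
    mul_nonneg (mul_nonneg hC.le (Real.rpow_nonneg (by positivity) _)) (Real.rpow_nonneg (by positivity) _)
  have h12 := c1_mono_mul (n := 2) rfl hΘ1 (Real.rpow_nonneg hcT.le _) hΞ0 hf1 hf2
  have h123 := c1_mono_mul (n := 3) rfl hΘ1 (mul_nonneg (Real.rpow_nonneg hcT.le _) hΞ0) (Nat.cast_nonneg _) h12 hf3
  have h1234 := c1_mono_mul (n := 4) rfl hΘ1 (mul_nonneg (mul_nonneg (Real.rpow_nonneg hcT.le _) hΞ0) (Nat.cast_nonneg _))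
    (Nat.cast_nonneg _) h123 hf4
  have h5 := c1_mono_one_add (n := 5) rfl hK2 hΘ1 hc0 h1234
  calc _ ≤ _ := h1
    _ ≤ ε + cT ^ t * (C * (1 + |β|) ^ p * (1 + (ℓ₀ : ℝ)) ^ p) * (boxIn S 0 ℓ₀).card * ((boxOut S 0 ℓ₀).card * ε) :=
        add_le_add hEu (mul_le_mul_of_nonneg_left hsum
          (mul_nonneg (mul_nonneg (Real.rpow_nonneg hcT.le _) hΞ0) (Nat.cast_nonneg _)))
    _ = (1 + cT ^ t * (C * (1 + |β|) ^ p * (1 + (ℓ₀ : ℝ)) ^ p) * (boxIn S 0 ℓ₀).card * (boxOut S 0 ℓ₀).card) * ε := by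
        ring
    _ ≤ (𝕂 ^ 5 * Θk ^ (((5 : ℕ) : ℝ) * 𝕔)) * ε := mul_le_mul_of_nonneg_right h5 hε0
    _ = _ := by
        rw [hε]
        rw [show 𝕂 ^ 9 = 𝕂 ^ 5 * 𝕂 ^ 4 by rw [← pow_add],
          show (((9 : ℕ) : ℝ) * 𝕔) = ((5 : ℕ) : ℝ) * 𝕔 + ((4 : ℕ) : ℝ) * 𝕔 by push_cast; ring,
          Real.rpow_add (by linarith)]
        ring

end Volume

end Summit.QuantumFields.QCD.Theorems.VonMisesCirclesC1
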